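import Summits.QuantumAdvantage.QuantumAdvantage.Theorems.WalkThreeStepProfile

/-!
# Rung (G♯₂) `ThreeStepFreeRungFive` (item stmt-QuantumAdvantage-23286), architecture (U), module U-d 2/5: locality hypotheses and
# ZONE FLIPS

Cell qa-qnc0, route OddPrimeWalk, support item stmt-QuantumAdvantage-23286 (planner qa-qnc0-p2 g27, ROUND-27 §3.6); prover
qn-prover-3 g16.

§1 The locality hypotheses of the three-weights law in the prover's RE-CUT form (per cut): `RLocal S g R` (the fire bit depends only on
the bits of the window `[g − R, g + R)` around the cut's OWN position and on `W mod p`), `BlockBlind S g a L` (the fire bit does not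
see the bits of `[a, a+L)` except through `W mod p`), `LocalOrBlind` (every cut is one or the other).  [The sketch's
`LocalModW S g (a−R) (a+L+R)` does not localise reads inside the interval and would not support the (FE) split; cuts positioned in the
interval that read only frozen far positions must be allowed — they are the blind/silent letters of the fibre.]
§2 `flipOn F x` (negate the coordinates in `F`), the prefix-count bookkeeping `wtPrefix_flipOn(_false/_true)`, ZONE FLIPS (`ZoneFlip`:
`p` equal bits inside `[z, z+m)`): below the zone nothing moves, beyond it prefix counts move by exactly `±p` — so every read outside the
open zone keeps its residue `mod p` and `W` moves by `±p` —, existence of a zone flip in any `2p − 1` consecutive positions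
(`exists_zoneFlip`, pigeonhole) and of two clean zones among four for two given reads (`exists_two_clean`).
Sequel: `WalkThreeStepSymmetry` (3/5), `WalkSwapConnect` (4/5), `WalkThreeStepThreeWeights` (5/5).
WHAT THIS IS NOT: bookkeeping; separation NOT moved.
-/

namespace Summit.QuantumAdvantage.AdviceFreeQNC0.LocalEngine

open Finset Classical

namespace RungU

variable {p n : ℕ}

/-! ### §1 The locality hypotheses (prover's re-cut of (H1)) -/

/-- Cut `g` is R-LOCAL: its fire bit depends only on the bits `i` with `g ≤ i + R`, `i < g + R` and on `W mod p`. -/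
def RLocal (S : ThreeStep p n) (g : Fin (n + 1)) (R : ℕ) : Prop :=
  ∀ x x' : Fin n → Bool, (∀ i : Fin n, g.val ≤ i.val + R → i.val < g.val + R → x i = x' i) →
    wt x % p = wt x' % p → S.y g x = S.y g x'

/-- Cut `g` is BLOCK-BLIND for `[a, a+L)`: its fire bit does not see those bits except through `W mod p`. -/
def BlockBlind (S : ThreeStep p n) (g : Fin (n + 1)) (a L : ℕ) : Prop :=
  ∀ x x' : Fin n → Bool, (∀ i : Fin n, ¬ (a ≤ i.val ∧ i.val < a + L) → x i = x' i) →
    wt x % p = wt x' % p → S.y g x = S.y g x'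

/-- (H1), prover's form: every cut is R-local or block-blind. -/
def LocalOrBlind (S : ThreeStep p n) (a L R : ℕ) : Prop := ∀ g : Fin (n + 1), RLocal S g R ∨ BlockBlind S g a L

/-! ### §2 Flipping a set of coordinates -/

/-- negate the coordinates in `F`. -/
def flipOn (F : Finset (Fin n)) (x : Fin n → Bool) : Fin n → Bool := fun i => if i ∈ F then !x i else x i

/-- inside `F` the bit is negated. -/
theorem flipOn_of_mem {F : Finset (Fin n)} {x : Fin n → Bool} {i : Fin n} (h : i ∈ F) : flipOn F x i = !x i := by
  unfold flipOn; rw [if_pos h]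

/-- outside `F` the bit is unchanged. -/
theorem flipOn_of_not_mem {F : Finset (Fin n)} {x : Fin n → Bool} {i : Fin n} (h : i ∉ F) : flipOn F x i = x i := by
  unfold flipOn; rw [if_neg h]

/-- **prefix counts under a flip**: ones lost and zeros gained below `r`. -/
theorem wtPrefix_flipOn (F : Finset (Fin n)) (x : Fin n → Bool) (r : ℕ) :
    wtPrefix (flipOn F x) r + (F.filter fun i => i.val < r ∧ x i = true).card
      = wtPrefix x r + (F.filter fun i => i.val < r ∧ x i = false).card := by
  unfold wtPrefix
  -- split both prefix counts along membership in F
  have s1 := Finset.card_filter_add_card_filter_not (s := univ.filter fun i : Fin n => i.val < r ∧ flipOn F x i = true)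
    (fun i => i ∈ F)
  have s2 := Finset.card_filter_add_card_filter_not (s := univ.filter fun i : Fin n => i.val < r ∧ x i = true)
    (fun i => i ∈ F)
  rw [Finset.filter_filter, Finset.filter_filter] at s1 s2
  have e1 : (univ.filter fun i : Fin n => (i.val < r ∧ flipOn F x i = true) ∧ i ∈ F)
      = F.filter fun i => i.val < r ∧ x i = false := by
    ext i
    simp only [Finset.mem_filter, Finset.mem_univ, true_and]
    constructor
    · rintro ⟨⟨h1, h2⟩, h3⟩
      rw [flipOn_of_mem h3] at h2
      refine ⟨h3, h1, ?_⟩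
      cases hx : x i
      · rfl
      · rw [hx] at h2; exact absurd h2 (by decide)
    · rintro ⟨h3, h1, h2⟩
      refine ⟨⟨h1, ?_⟩, h3⟩
      rw [flipOn_of_mem h3, h2]; rfl
  have e2 : (univ.filter fun i : Fin n => (i.val < r ∧ flipOn F x i = true) ∧ i ∉ F)
      = univ.filter fun i : Fin n => (i.val < r ∧ x i = true) ∧ i ∉ F := by
    apply Finset.filter_congr
    intro i _
    constructor
    · rintro ⟨⟨h1, h2⟩, h3⟩; rw [flipOn_of_not_mem h3] at h2; exact ⟨⟨h1, h2⟩, h3⟩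
    · rintro ⟨⟨h1, h2⟩, h3⟩; refine ⟨⟨h1, ?_⟩, h3⟩; rw [flipOn_of_not_mem h3]; exact h2
  have e3 : (univ.filter fun i : Fin n => (i.val < r ∧ x i = true) ∧ i ∈ F)
      = F.filter fun i => i.val < r ∧ x i = true := by
    ext i
    simp only [Finset.mem_filter, Finset.mem_univ, true_and]
    tauto
  rw [e1, e2] at s1
  rw [e3] at s2
  omega

/-- flipping `false`s: prefix counts grow by the number of flipped positions below `r`. -/
theorem wtPrefix_flipOn_false (F : Finset (Fin n)) (x : Fin n → Bool) (hF : ∀ i ∈ F, x i = false) (r : ℕ) :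
    wtPrefix (flipOn F x) r = wtPrefix x r + (F.filter fun i => i.val < r).card := by
  have h := wtPrefix_flipOn F x r
  have e1 : (F.filter fun i => i.val < r ∧ x i = true) = ∅ := by
    rw [Finset.filter_eq_empty_iff]
    intro i hi ⟨_, h2⟩
    rw [hF i hi] at h2
    exact Bool.false_ne_true h2
  have e2 : (F.filter fun i => i.val < r ∧ x i = false) = F.filter fun i => i.val < r := by
    apply Finset.filter_congr
    intro i hi
    exact ⟨fun h => h.1, fun h => ⟨h, hF i hi⟩⟩
  rw [e1, Finset.card_empty, add_zero, e2] at h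
  exact h

/-- flipping `true`s: prefix counts shrink by the number of flipped positions below `r`. -/
theorem wtPrefix_flipOn_true (F : Finset (Fin n)) (x : Fin n → Bool) (hF : ∀ i ∈ F, x i = true) (r : ℕ) :
    wtPrefix (flipOn F x) r + (F.filter fun i => i.val < r).card = wtPrefix x r := by
  have h := wtPrefix_flipOn F x r
  have e1 : (F.filter fun i => i.val < r ∧ x i = false) = ∅ := by
    rw [Finset.filter_eq_empty_iff]
    intro i hi ⟨_, h2⟩
    rw [hF i hi] at h2
    exact absurd h2 (by decide)
  have e2 : (F.filter fun i => i.val < r ∧ x i = true) = F.filter fun i => i.val < r := by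
    apply Finset.filter_congr
    intro i hi
    exact ⟨fun h => h.1, fun h => ⟨h, hF i hi⟩⟩
  rw [e1, Finset.card_empty, add_zero, e2] at h
  exact h

/-- A ZONE flip: `F` has `p` elements, all inside `[z, z + m)`, and `x` is constant on `F`. -/
structure ZoneFlip (p : ℕ) (x : Fin n → Bool) (F : Finset (Fin n)) (z m : ℕ) : Prop where
  card_eq : F.card = p
  inside : ∀ i ∈ F, z ≤ i.val ∧ i.val < z + m
  const : (∀ i ∈ F, x i = false) ∨ (∀ i ∈ F, x i = true)

namespace ZoneFlip

variable {x : Fin n → Bool} {F : Finset (Fin n)} {z m : ℕ}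

/-- below the zone nothing changes. -/
theorem wtPrefix_of_le (h : ZoneFlip p x F z m) {r : ℕ} (hr : r ≤ z) : wtPrefix (flipOn F x) r = wtPrefix x r := by
  have e : (F.filter fun i => i.val < r) = ∅ := by
    rw [Finset.filter_eq_empty_iff]
    intro i hi hlt
    have := (h.inside i hi).1
    omega
  rcases h.const with hc | hc
  · rw [wtPrefix_flipOn_false F x hc r, e, Finset.card_empty, add_zero]
  · have := wtPrefix_flipOn_true F x hc r
    rw [e, Finset.card_empty, add_zero] at this
    exact this

/-- beyond the zone the prefix count moves by exactly `p` (up or down). -/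
theorem wtPrefix_of_ge (h : ZoneFlip p x F z m) {r : ℕ} (hr : z + m ≤ r) :
    wtPrefix (flipOn F x) r = wtPrefix x r + p ∨ wtPrefix (flipOn F x) r + p = wtPrefix x r := by
  have e : (F.filter fun i => i.val < r) = F := by
    apply Finset.filter_true_of_mem
    intro i hi
    have := (h.inside i hi).2
    omega
  rcases h.const with hc | hc
  · left; rw [wtPrefix_flipOn_false F x hc r, e, h.card_eq]
  · right
    have := wtPrefix_flipOn_true F x hc r
    rw [e, h.card_eq] at this
    exact this

/-- a read outside the open zone keeps its residue `mod p`. -/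
theorem wtPrefix_mod_eq (h : ZoneFlip p x F z m) {r : ℕ} (hr : ¬ (z < r ∧ r < z + m)) :
    wtPrefix (flipOn F x) r % p = wtPrefix x r % p := by
  by_cases h1 : r ≤ z
  · rw [h.wtPrefix_of_le h1]
  · rcases h.wtPrefix_of_ge (r := r) (by omega) with e | e
    · rw [e, Nat.add_mod_right]
    · rw [← e, Nat.add_mod_right]

/-- the total weight moves by `p`: same residue `mod p`… -/
theorem wt_mod_eq (h : ZoneFlip p x F z m) (hn : z + m ≤ n) : wt (flipOn F x) % p = wt x % p := by
  rw [Coset21.wt_eq_wtPrefix, Coset21.wt_eq_wtPrefix]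
  exact h.wtPrefix_mod_eq (by omega)

/-- … and by `± p` in `ZMod 3`. -/
theorem wt_cast_three (h : ZoneFlip p x F z m) (hn : z + m ≤ n) :
    ((wt (flipOn F x) : ℕ) : ZMod 3) = (wt x : ℕ) + (p : ℕ) ∨ ((wt (flipOn F x) : ℕ) : ZMod 3) = (wt x : ℕ) - (p : ℕ) := by
  rw [Coset21.wt_eq_wtPrefix, Coset21.wt_eq_wtPrefix]
  rcases h.wtPrefix_of_ge hn with e | e
  · left; rw [e, Nat.cast_add]
  · right; rw [← e, Nat.cast_add]; ring

/-- coordinates below the zone are untouched. -/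
theorem apply_of_lt (h : ZoneFlip p x F z m) {i : Fin n} (hi : i.val < z) : flipOn F x i = x i := by
  apply flipOn_of_not_mem
  intro hF
  have := (h.inside i hF).1
  omega

end ZoneFlip

/-- **A zone of `2p − 1` positions inside `[0, n)` always admits a zone flip** (it holds `p` equal bits). -/
theorem exists_zoneFlip (hp : 1 ≤ p) (x : Fin n → Bool) (z : ℕ) (hz : z + (2 * p - 1) ≤ n) :
    ∃ F : Finset (Fin n), ZoneFlip p x F z (2 * p - 1) := by
  set Zs : Finset (Fin n) := univ.filter fun i : Fin n => z ≤ i.val ∧ i.val < z + (2 * p - 1) with hZs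
  have hcard : Zs.card = 2 * p - 1 := by
    have himg : Zs.image Fin.val = Finset.Ico z (z + (2 * p - 1)) := by
      ext y
      simp only [hZs, Finset.mem_image, Finset.mem_filter, Finset.mem_univ, true_and, Finset.mem_Ico]
      constructor
      · rintro ⟨i, ⟨h1, h2⟩, rfl⟩; exact ⟨h1, h2⟩
      · rintro ⟨h1, h2⟩; exact ⟨⟨y, by omega⟩, ⟨h1, h2⟩, rfl⟩
    rw [← Finset.card_image_of_injective Zs Fin.val_injective, himg, Nat.card_Ico]
    omega
  have hsplit := Finset.card_filter_add_card_filter_not (s := Zs) (fun i => x i = false)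
  by_cases hf : p ≤ (Zs.filter fun i => x i = false).card
  · obtain ⟨F, hF, hFc⟩ := Finset.exists_subset_card_eq hf
    refine ⟨F, hFc, fun i hi => ?_, Or.inl fun i hi => (Finset.mem_filter.mp (hF hi)).2⟩
    have := (Finset.mem_filter.mp (hF hi)).1
    rw [hZs, Finset.mem_filter] at this
    exact this.2
  · have ht : p ≤ (Zs.filter fun i => ¬ x i = false).card := by omega
    obtain ⟨F, hF, hFc⟩ := Finset.exists_subset_card_eq ht
    refine ⟨F, hFc, fun i hi => ?_, Or.inr fun i hi => ?_⟩
    · have := (Finset.mem_filter.mp (hF hi)).1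
      rw [hZs, Finset.mem_filter] at this
      exact this.2
    · have := (Finset.mem_filter.mp (hF hi)).2
      cases hx : x i
      · exact absurd hx this
      · rfl

/-- **two clean zones among four**: two points spoil at most two of four disjoint zones. -/
theorem exists_two_clean (z₀ m r₁ r₂ : ℕ) :
    ∃ j₁ j₂ : ℕ, j₁ < j₂ ∧ j₂ < 4 ∧
      ¬ (z₀ + j₁ * m < r₁ ∧ r₁ < z₀ + j₁ * m + m) ∧ ¬ (z₀ + j₁ * m < r₂ ∧ r₂ < z₀ + j₁ * m + m) ∧
      ¬ (z₀ + j₂ * m < r₁ ∧ r₁ < z₀ + j₂ * m + m) ∧ ¬ (z₀ + j₂ * m < r₂ ∧ r₂ < z₀ + j₂ * m + m) := by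
  -- a point lies strictly inside at most one zone; case on the zones of r₁ and r₂
  by_cases a0 : z₀ + 0 * m < r₁ ∧ r₁ < z₀ + 0 * m + m <;> by_cases b0 : z₀ + 0 * m < r₂ ∧ r₂ < z₀ + 0 * m + m <;>
  by_cases a1 : z₀ + 1 * m < r₁ ∧ r₁ < z₀ + 1 * m + m <;> by_cases b1 : z₀ + 1 * m < r₂ ∧ r₂ < z₀ + 1 * m + m
  all_goals first
    | exact ⟨0, 1, by omega, by omega, a0, b0, a1, b1⟩
    | skip
  all_goals
    by_cases a2 : z₀ + 2 * m < r₁ ∧ r₁ < z₀ + 2 * m + m <;> by_cases b2 : z₀ + 2 * m < r₂ ∧ r₂ < z₀ + 2 * m + m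
  all_goals first
    | exact ⟨0, 2, by omega, by omega, a0, b0, a2, b2⟩
    | exact ⟨1, 2, by omega, by omega, a1, b1, a2, b2⟩
    | skip
  all_goals
    by_cases a3 : z₀ + 3 * m < r₁ ∧ r₁ < z₀ + 3 * m + m <;> by_cases b3 : z₀ + 3 * m < r₂ ∧ r₂ < z₀ + 3 * m + m
  all_goals first
    | exact ⟨0, 3, by omega, by omega, a0, b0, a3, b3⟩
    | exact ⟨1, 3, by omega, by omega, a1, b1, a3, b3⟩
    | exact ⟨2, 3, by omega, by omega, a2, b2, a3, b3⟩
    | (exfalso; omega)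


end RungU

end Summit.QuantumAdvantage.AdviceFreeQNC0.LocalEngine
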